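import Summits.CriticalPhenomena.SAWScalingLimit.Theorems.SAWDevelopingMapObservableToSLETypeLadderCarvedReductionSqueezeShadow
import HarnessLib

/-!
# The TWO-PIECE escape lemma, flatness-free form (piece (G2-fam-b) of stub T2b″)

Crux `SAWDevelopingMap.ObservableToSLE` (stmt-CriticalPhenomena-10472), line `six-class-type-ladder`,
stub T2b″ `stub_carvedReduction_squeezeSolid`.  Landing target:
`Summits/CriticalPhenomena/SAWScalingLimit/Theorems/SAWDevelopingMapObservableToSLETypeLadderCarvedReductionSqueezeEscape.lean`
(`--supports stmt-CriticalPhenomena-10472`).  Sequel of `…SqueezeShadow` (p132188: rows, row walks).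

The repaired squeeze applies ARL″ in the outer Jordan approximants `E_n` of the pinned carved
domains, and the outer admissible family `N` of `E_n` must CONTAIN the pinned carved lattice region
`Reach_k`, which hugs, from above and at lattice distance, the whole flat gate segment of `∂E_n`
INCLUDING ITS TWO CORNERS.  So the set `S` of deep vertices (whose main component is `N`) cannot be
the floor line's (`FloorRatio.exists_pathIn_escape`: exempt discs well inside a flat disc): the
exemption has to cover the slab under the entire flat segment.  This file proves the escape lemma
of the flatness-free deep set adapted to the design of `E_n` at a gate (flat segment
`[Re p - ρ_c, Re p + ρ_c]`, vertical legs, the closed box `B = [Re p ± ρ_c] × [Im p - ρ_c', Im p]`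
removed):

* deep (`S`): `δ c_u ∈ Ω`; `u` is NOT in an EXCLUDED ZONE
  `Z_i = {|Re(δ c_u) - Re(p i)| < ρₓ ∧ mlo i ≤ row u < μ i}` (free thresholds `μ i` — at the far
  gate many rows above the floor — and a floor depth `mlo i`); the closed `r`-disc about `δ c_u`
  lies in `Ω ∪ X`, the exempt set `X` lying in the slabs
  `{|Re z - Re(p i)| ≤ ρₓ - 10δ, Im(p i) - σ ≤ Im z ≤ Im(p i)}`;
* links: vertices on or below the floor have row `< μ i`; vertices of height `≥ Im(p i) - D` have
  row `≥ mlo i` (`σ + 10δ ≤ D`); rows `≥ mlo i` have height `≥ Im(p i) - ρ_c' + 8δ`; the boxes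
  `B_i` miss `Ω`; `3δ ≤ ρ_c ≤ ρₓ`, `8δ ≤ ρ_c'`, `9δ ≤ r`, `Ω ⊆ B(0, R)`, connected exterior with
  frontier `∂Ω`.

Routes (all ending by the shifted shadow of an exterior path, in ABSTRACT form `twoPiece_shadow`:
no deep vertex sits within `9δ` of, and `≥ δ` below, an exempt non-domain point — given by the
zones): witness route `twoPiece_witness`, low route `twoPiece_low`, and the zone route (walk INWARD
along the row to `|ΔRe| ≤ ρ_c - 2δ`, then a column into the removed box).  Registered:
`stub_carvedReduction_twoPieceEscape`.  Sources: Duminil-Copin–Smirnov, Ann. of Math. 175 (2012) §3;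
G. Grimmett, Percolation (1999) §1.6.
-/

noncomputable section

open scoped Topology
open Filter Set Metric
open Literature.Probability.LatticeModels (HexVertex hexGraph hexCenter Site)
open Literature.Probability.RandomPlanarGeometry
open Literature.Probability.RandomPlanarGeometry.SAW
open Literature.Probability.Percolation (PathIn hexCenter_im hexCenter_re)

namespace Summit.CriticalPhenomena.SAWScalingLimit.Theorems.ObservableToSLE.TypeLadder

open Summit.CriticalPhenomena.SAWScalingLimit.Theorems.ObservableToSLE.FloorRatio
open Summit.CriticalPhenomena.SAWScalingLimit.Theorems.ObservableToSLER.TwoPiece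
  (exists_walk_column re_smul_hexCenter exists_walk_within_of_isPreconnected)

section TwoPieceEscape

variable {Ω X : Set ℂ} {δ r R : ℝ} {S : Set HexVertex}

/-- **The shifted shadow, abstract form.**  Let `S` be a set of vertices `u` with `δ c_u ∈ Ω` whose
closed `r`-discs lie in `Ω ∪ X` (`9δ ≤ r`, `Ω ⊆ B(0, R)`), and assume NO vertex of `S` lies within
`9δ` of, and at least `δ` below, an exempt non-domain point of `X`.  Then from every vertex within
`4δ` of the point `5δ` below an exterior point `e ∉ cl Ω` there is a lattice path outside `S` to a
vertex of norm `≥ R + 5δ` (the shadow, within `4δ`, of an exterior path from `e` to the far point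
`R + 12δ` shifted down by `5δ`). -/
theorem twoPiece_shadow (hδ : 0 < δ) (hr : 9 * δ ≤ r) (hR0 : 0 ≤ R) (hR : ∀ z ∈ Ω, ‖z‖ < R)
    (hE : IsConnected (closure Ω)ᶜ)
    (hS : ∀ u ∈ S, (δ : ℂ) * hexCenter u ∈ Ω ∧ closedBall ((δ : ℂ) * hexCenter u) r ⊆ Ω ∪ X)
    (hXS : ∀ z ∈ X, z ∉ Ω → ∀ u : HexVertex, dist ((δ : ℂ) * hexCenter u) z ≤ 9 * δ →
      ((δ : ℂ) * hexCenter u).im ≤ z.im - δ → u ∉ S)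
    {e : ℂ} (he : e ∈ (closure Ω)ᶜ) {s₀ : HexVertex}
    (hs₀ : dist ((δ : ℂ) * hexCenter s₀) (e - ((5 * δ : ℝ) : ℂ) * Complex.I) ≤ 4 * δ) :
    ∃ w : HexVertex, R + 5 * δ ≤ ‖(δ : ℂ) * hexCenter w‖ ∧ PathIn hexGraph Sᶜ s₀ w := by
  -- the shift and the far exterior point
  set sh : ℂ → ℂ := fun z => z - ((5 * δ : ℝ) : ℂ) * Complex.I with hsh
  have hsh_dist : ∀ z : ℂ, dist (sh z) z = 5 * δ := by
    intro z
    rw [hsh, dist_eq_norm, sub_sub_cancel_left, norm_neg, norm_mul, Complex.norm_real,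
      Complex.norm_I, mul_one, Real.norm_of_nonneg (by positivity)]
  have hsh_im : ∀ z : ℂ, (sh z).im = z.im - 5 * δ := fun z => by simp [hsh]
  set qf : ℂ := ((R + 12 * δ : ℝ) : ℂ) with hqf
  have hclΩ : closure Ω ⊆ closedBall (0 : ℂ) R :=
    (closure_mono fun z hz => mem_ball_zero_iff.2 (hR z hz)).trans closure_ball_subset_closedBall
  have hqfE : qf ∈ (closure Ω)ᶜ := by
    intro h
    have h1 := mem_closedBall_zero_iff.1 (hclΩ h)
    rw [hqf, Complex.norm_real, Real.norm_of_nonneg (by positivity)] at h1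
    linarith
  -- an exterior path from `e` to `qf`, shifted down
  have hEo : IsOpen (closure Ω)ᶜ := isClosed_closure.isOpen_compl
  have hpc : IsPathConnected (closure Ω)ᶜ := hEo.isConnected_iff_isPathConnected.1 hE
  have hJ : JoinedIn (closure Ω)ᶜ e qf := hpc.joinedIn e he qf hqfE
  set γ : Path e qf := hJ.somePath with hγ
  set P : Set ℂ := sh '' range γ with hP
  have hPc : IsPreconnected P :=
    (isConnected_range γ.continuous).isPreconnected.image _ (by fun_prop : Continuous sh).continuousOn
  have hx : sh e ∈ P := ⟨e, ⟨0, γ.source⟩, rfl⟩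
  have hy : sh qf ∈ P := ⟨qf, ⟨1, γ.target⟩, rfl⟩
  obtain ⟨w, pw, hwy, hsupp⟩ :=
    exists_walk_within_of_isPreconnected hPc hδ (r := 4 * δ) (by linarith) hx hy hs₀
  refine ⟨w, ?_, pathIn_of_walk pw fun u hu huS => ?_⟩
  · -- the end is far
    have h1 : ‖sh qf‖ ≤ ‖(δ : ℂ) * hexCenter w‖ + dist ((δ : ℂ) * hexCenter w) (sh qf) := by
      rw [dist_comm, dist_eq_norm]; exact norm_le_norm_add_norm_sub' (sh qf) ((δ : ℂ) * hexCenter w)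
    have h2 : R + 12 * δ ≤ ‖sh qf‖ := by
      have h3 : (sh qf).re = R + 12 * δ := by simp [hsh, hqf]
      rw [← h3]
      exact (le_abs_self _).trans (Complex.abs_re_le_norm _)
    linarith
  · -- no vertex of `S` on the shadow
    obtain ⟨z', ⟨z, ⟨t, rfl⟩, rfl⟩, hd⟩ := hsupp u hu
    have hzE : γ t ∈ (closure Ω)ᶜ := hJ.somePath_mem t
    have hzΩ : γ t ∉ Ω := fun h => hzE (subset_closure h)
    obtain ⟨huΩ, hdisc⟩ := hS u huS
    have hduz : dist ((δ : ℂ) * hexCenter u) (γ t) ≤ 9 * δ := by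
      calc dist ((δ : ℂ) * hexCenter u) (γ t)
          ≤ dist ((δ : ℂ) * hexCenter u) (sh (γ t)) + dist (sh (γ t)) (γ t) := dist_triangle _ _ _
        _ ≤ 4 * δ + 5 * δ := add_le_add hd (hsh_dist _).le
        _ = 9 * δ := by ring
    have hzU : γ t ∈ Ω ∪ X := hdisc (mem_closedBall.2 (by rw [dist_comm]; exact hduz.trans hr))
    rcases hzU with hzΩ' | hzX
    · exact hzΩ hzΩ'
    · have huim : ((δ : ℂ) * hexCenter u).im ≤ (γ t).im - δ := by
        have h1 := im_sub_im_le_dist ((δ : ℂ) * hexCenter u) (sh (γ t))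
        rw [hsh_im] at h1
        linarith
      exact hXS (γ t) hzX hzΩ u hduz huim huS

/-- **The witness route.**  If `y ∉ Ω ∪ X` is within `r` of `δ c_v`, then `v` is joined outside `S`
to a far vertex: greedy descent towards `y` (all discs about vertices of `S` lie in `Ω ∪ X ∌ y`),
a column of height `5δ` next to `y`, and the shifted shadow from an exterior point next to `y`. -/
theorem twoPiece_witness (hδ : 0 < δ) (hr : 9 * δ ≤ r) (hR0 : 0 ≤ R) (hR : ∀ z ∈ Ω, ‖z‖ < R)
    (hE : IsConnected (closure Ω)ᶜ) (hEfr : frontier (closure Ω)ᶜ = frontier Ω)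
    (hS : ∀ u ∈ S, (δ : ℂ) * hexCenter u ∈ Ω ∧ closedBall ((δ : ℂ) * hexCenter u) r ⊆ Ω ∪ X)
    (hXS : ∀ z ∈ X, z ∉ Ω → ∀ u : HexVertex, dist ((δ : ℂ) * hexCenter u) z ≤ 9 * δ →
      ((δ : ℂ) * hexCenter u).im ≤ z.im - δ → u ∉ S)
    {v : HexVertex} {y : ℂ} (hy : y ∉ Ω ∪ X) (hvy : dist ((δ : ℂ) * hexCenter v) y ≤ r) :
    ∃ w : HexVertex, R + 5 * δ ≤ ‖(δ : ℂ) * hexCenter w‖ ∧ PathIn hexGraph Sᶜ v w := by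
  have hSU : ∀ u ∈ S, closedBall ((δ : ℂ) * hexCenter u) r ⊆ Ω ∪ X := fun u hu => (hS u hu).2
  have hyΩ : y ∉ Ω := fun h => hy (Or.inl h)
  -- (1) towards the witness
  obtain ⟨z₁, hz₁y, hvz₁⟩ := exists_pathIn_towards hδ hSU hy hvy
  -- (2) a column of height `5δ`
  obtain ⟨w₁, q, hw₁, hq⟩ := exists_walk_column hδ z₁ (L := 5 * δ) (by positivity)
  have hz₁w₁ : PathIn hexGraph Sᶜ z₁ w₁ := by
    refine pathIn_of_walk q fun u hu huS => hy (hSU u huS ?_)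
    rw [mem_closedBall, dist_comm]
    calc dist ((δ : ℂ) * hexCenter u) y
        ≤ dist ((δ : ℂ) * hexCenter u) ((δ : ℂ) * hexCenter z₁) + dist ((δ : ℂ) * hexCenter z₁) y :=
          dist_triangle _ _ _
      _ ≤ (5 * δ + 2 * δ) + δ := add_le_add (hq u hu).2.2.2 hz₁y
      _ ≤ r := by linarith
  -- (3) an exterior point next to the witness, and the shadow
  obtain ⟨e, heE, hey⟩ := exists_mem_compl_closure_near hEfr hyΩ hδ
  have hstart : dist ((δ : ℂ) * hexCenter w₁) (e - ((5 * δ : ℝ) : ℂ) * Complex.I) ≤ 4 * δ := by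
    have hw₁s := hq w₁ q.end_mem_support
    have h1 : dist ((δ : ℂ) * hexCenter w₁) ((δ : ℂ) * hexCenter z₁ - ((5 * δ : ℝ) : ℂ) * Complex.I) ≤
        2 * δ := by
      refine (dist_le_abs_re_add_abs_im _ _).trans ?_
      have hre : ((δ : ℂ) * hexCenter w₁ - ((δ : ℂ) * hexCenter z₁ - ((5 * δ : ℝ) : ℂ) * Complex.I)).re =
          ((δ : ℂ) * hexCenter w₁).re - ((δ : ℂ) * hexCenter z₁).re := by simp
      have him : ((δ : ℂ) * hexCenter w₁ - ((δ : ℂ) * hexCenter z₁ - ((5 * δ : ℝ) : ℂ) * Complex.I)).im =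
          ((δ : ℂ) * hexCenter w₁).im - ((δ : ℂ) * hexCenter z₁).im + 5 * δ := by simp; ring
      rw [hre, him]
      have h2 : |((δ : ℂ) * hexCenter w₁).re - ((δ : ℂ) * hexCenter z₁).re| ≤ δ := hw₁s.2.2.1
      have h3 : |((δ : ℂ) * hexCenter w₁).im - ((δ : ℂ) * hexCenter z₁).im + 5 * δ| ≤ δ := by
        rw [abs_le]; constructor <;> linarith [hw₁s.2.1, hw₁]
      linarith
    have h2 : dist ((δ : ℂ) * hexCenter z₁ - ((5 * δ : ℝ) : ℂ) * Complex.I)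
        (e - ((5 * δ : ℝ) : ℂ) * Complex.I) ≤ 2 * δ := by
      rw [dist_sub_right]
      calc dist ((δ : ℂ) * hexCenter z₁) e ≤ dist ((δ : ℂ) * hexCenter z₁) y + dist e y :=
            dist_triangle_right _ _ _
        _ ≤ δ + δ := add_le_add hz₁y hey.le
        _ = 2 * δ := by ring
    linarith [dist_triangle ((δ : ℂ) * hexCenter w₁)
      ((δ : ℂ) * hexCenter z₁ - ((5 * δ : ℝ) : ℂ) * Complex.I) (e - ((5 * δ : ℝ) : ℂ) * Complex.I)]
  obtain ⟨w, hw, hw₁w⟩ := twoPiece_shadow hδ hr hR0 hR hE hS hXS heE hstart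
  exact ⟨w, hw, (hvz₁.trans hz₁w₁).trans hw₁w⟩

/-- **The low route.**  A vertex `u` with `δ c_u ∉ Ω` above a SAFE `7δ`-column (no vertex of `S`
within lateral distance `δ` and `7δ` below `δ c_u`) is joined outside `S` to a far vertex: a column
of height `5δ` and the shifted shadow from an exterior point next to `δ c_u`. -/
theorem twoPiece_low (hδ : 0 < δ) (hr : 9 * δ ≤ r) (hR0 : 0 ≤ R) (hR : ∀ z ∈ Ω, ‖z‖ < R)
    (hE : IsConnected (closure Ω)ᶜ) (hEfr : frontier (closure Ω)ᶜ = frontier Ω)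
    (hS : ∀ u ∈ S, (δ : ℂ) * hexCenter u ∈ Ω ∧ closedBall ((δ : ℂ) * hexCenter u) r ⊆ Ω ∪ X)
    (hXS : ∀ z ∈ X, z ∉ Ω → ∀ u : HexVertex, dist ((δ : ℂ) * hexCenter u) z ≤ 9 * δ →
      ((δ : ℂ) * hexCenter u).im ≤ z.im - δ → u ∉ S)
    {u : HexVertex} (huΩ : (δ : ℂ) * hexCenter u ∉ Ω)
    (hcol : ∀ x : HexVertex, |((δ : ℂ) * hexCenter x).re - ((δ : ℂ) * hexCenter u).re| ≤ δ →
      ((δ : ℂ) * hexCenter u).im - 7 * δ ≤ ((δ : ℂ) * hexCenter x).im →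
      ((δ : ℂ) * hexCenter x).im ≤ ((δ : ℂ) * hexCenter u).im → x ∉ S) :
    ∃ w : HexVertex, R + 5 * δ ≤ ‖(δ : ℂ) * hexCenter w‖ ∧ PathIn hexGraph Sᶜ u w := by
  obtain ⟨w₁, q, hw₁, hq⟩ := exists_walk_column hδ u (L := 5 * δ) (by positivity)
  have huw₁ : PathIn hexGraph Sᶜ u w₁ := by
    refine pathIn_of_walk q fun x hx hxS => ?_
    obtain ⟨h1, h2, h3, -⟩ := hq x hx
    exact hcol x h3 (by linarith) h1 hxS
  obtain ⟨e, heE, heu⟩ := exists_mem_compl_closure_near hEfr huΩ hδ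
  have hstart : dist ((δ : ℂ) * hexCenter w₁) (e - ((5 * δ : ℝ) : ℂ) * Complex.I) ≤ 4 * δ := by
    have hw₁s := hq w₁ q.end_mem_support
    have h1 : dist ((δ : ℂ) * hexCenter w₁) ((δ : ℂ) * hexCenter u - ((5 * δ : ℝ) : ℂ) * Complex.I) ≤
        2 * δ := by
      refine (dist_le_abs_re_add_abs_im _ _).trans ?_
      have hre : ((δ : ℂ) * hexCenter w₁ - ((δ : ℂ) * hexCenter u - ((5 * δ : ℝ) : ℂ) * Complex.I)).re =
          ((δ : ℂ) * hexCenter w₁).re - ((δ : ℂ) * hexCenter u).re := by simp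
      have him' : ((δ : ℂ) * hexCenter w₁ - ((δ : ℂ) * hexCenter u - ((5 * δ : ℝ) : ℂ) * Complex.I)).im =
          ((δ : ℂ) * hexCenter w₁).im - ((δ : ℂ) * hexCenter u).im + 5 * δ := by simp; ring
      rw [hre, him']
      have h2 : |((δ : ℂ) * hexCenter w₁).re - ((δ : ℂ) * hexCenter u).re| ≤ δ := hw₁s.2.2.1
      have h3 : |((δ : ℂ) * hexCenter w₁).im - ((δ : ℂ) * hexCenter u).im + 5 * δ| ≤ δ := by
        rw [abs_le]; constructor <;> linarith [hw₁s.2.1, hw₁]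
      linarith
    have h2 : dist ((δ : ℂ) * hexCenter u - ((5 * δ : ℝ) : ℂ) * Complex.I)
        (e - ((5 * δ : ℝ) : ℂ) * Complex.I) ≤ δ := by
      rw [dist_sub_right, dist_comm]; exact heu.le
    linarith [dist_triangle ((δ : ℂ) * hexCenter w₁)
      ((δ : ℂ) * hexCenter u - ((5 * δ : ℝ) : ℂ) * Complex.I) (e - ((5 * δ : ℝ) : ℂ) * Complex.I)]
  obtain ⟨w, hw, hw₁w⟩ := twoPiece_shadow hδ hr hR0 hR hE hS hXS heE hstart
  exact ⟨w, hw, huw₁.trans hw₁w⟩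

/-! ### The concrete deep set: excluded zones, removed boxes, exempt slabs -/

variable {p : Fin 2 → ℂ} {ρₓ ρc ρc' σ D : ℝ} {μ mlo : Fin 2 → ℤ}

/-- **THE TWO-PIECE ESCAPE LEMMA (flatness-free form).**  See the module docstring for the setting.
Every vertex violating one of the three deep conditions is joined OUTSIDE `S` to a vertex of norm
`≥ R + 5δ`. -/
theorem twoPiece_exists_pathIn_escape (hδ : 0 < δ) (hr : 9 * δ ≤ r) (hR0 : 0 ≤ R)
    (hR : ∀ z ∈ Ω, ‖z‖ < R) (hE : IsConnected (closure Ω)ᶜ) (hEfr : frontier (closure Ω)ᶜ = frontier Ω)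
    (hρc : 3 * δ ≤ ρc) (hρcₓ : ρc ≤ ρₓ) (hρc' : 8 * δ ≤ ρc') (hσD : σ + 10 * δ ≤ D) (hσ : 0 ≤ σ)
    (hS : ∀ u ∈ S, (δ : ℂ) * hexCenter u ∈ Ω ∧
      (∀ i, ¬ (|((δ : ℂ) * hexCenter u).re - (p i).re| < ρₓ ∧ mlo i ≤ u.1 1 ∧ u.1 1 < μ i)) ∧
      closedBall ((δ : ℂ) * hexCenter u) r ⊆ Ω ∪ X)
    (hX : ∀ z ∈ X, ∃ i, |z.re - (p i).re| ≤ ρₓ - 10 * δ ∧ (p i).im - σ ≤ z.im ∧ z.im ≤ (p i).im)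
    (hB : ∀ i (z : ℂ), |z.re - (p i).re| ≤ ρc → (p i).im - ρc' ≤ z.im → z.im ≤ (p i).im → z ∉ Ω)
    (hμ : ∀ i (u : HexVertex), ((δ : ℂ) * hexCenter u).im ≤ (p i).im → u.1 1 < μ i)
    (hmlo : ∀ i (u : HexVertex), (p i).im - D ≤ ((δ : ℂ) * hexCenter u).im → mlo i ≤ u.1 1)
    (hzone : ∀ i (u : HexVertex), mlo i ≤ u.1 1 → (p i).im - ρc' + 8 * δ ≤ ((δ : ℂ) * hexCenter u).im)
    {v : HexVertex}
    (hv : ¬ ((δ : ℂ) * hexCenter v ∈ Ω ∧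
      (∀ i, ¬ (|((δ : ℂ) * hexCenter v).re - (p i).re| < ρₓ ∧ mlo i ≤ v.1 1 ∧ v.1 1 < μ i)) ∧
      closedBall ((δ : ℂ) * hexCenter v) r ⊆ Ω ∪ X)) :
    ∃ w : HexVertex, R + 5 * δ ≤ ‖(δ : ℂ) * hexCenter w‖ ∧ PathIn hexGraph Sᶜ v w := by
  have hS' : ∀ u ∈ S, (δ : ℂ) * hexCenter u ∈ Ω ∧ closedBall ((δ : ℂ) * hexCenter u) r ⊆ Ω ∪ X :=
    fun u hu => ⟨(hS u hu).1, (hS u hu).2.2⟩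
  have hr0 : 0 ≤ r := by linarith
  -- a vertex in an excluded zone is outside `S`
  have zoneS : ∀ (i : Fin 2) (u : HexVertex), |((δ : ℂ) * hexCenter u).re - (p i).re| < ρₓ →
      mlo i ≤ u.1 1 → u.1 1 < μ i → u ∉ S :=
    fun i u h1 h2 h3 huS => (hS u huS).2.1 i ⟨h1, h2, h3⟩
  -- the abstract shadow hypothesis holds: exempt non-domain points have no deep vertex below
  have hXS : ∀ z ∈ X, z ∉ Ω → ∀ u : HexVertex, dist ((δ : ℂ) * hexCenter u) z ≤ 9 * δ →
      ((δ : ℂ) * hexCenter u).im ≤ z.im - δ → u ∉ S := by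
    intro z hzX _ u hdu huim
    obtain ⟨i, hzre, hzlo, hzhi⟩ := hX z hzX
    refine zoneS i u ?_ (hmlo i u ?_) (hμ i u (by linarith))
    · have h1 := (le_abs_self _).trans ((Complex.abs_re_le_norm _).trans_eq (dist_eq_norm _ _).symm)
        |>.trans hdu
      have hdu' : dist z ((δ : ℂ) * hexCenter u) ≤ 9 * δ := by rw [dist_comm]; exact hdu
      have h2 := (le_abs_self _).trans ((Complex.abs_re_le_norm _).trans_eq (dist_eq_norm _ _).symm)
        |>.trans hdu'
      rw [Complex.sub_re] at h1 h2
      obtain ⟨ha, hb⟩ := abs_le.1 hzre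
      rw [abs_lt]; constructor <;> linarith
    · have h1 := im_sub_im_le_dist z ((δ : ℂ) * hexCenter u)
      rw [dist_comm] at h1
      linarith
  -- the low route from a vertex outside `Ω` with a column inside a removed box
  have lowB : ∀ (i : Fin 2) (u : HexVertex), |((δ : ℂ) * hexCenter u).re - (p i).re| ≤ ρc - δ →
      (p i).im - ρc' + 7 * δ ≤ ((δ : ℂ) * hexCenter u).im → ((δ : ℂ) * hexCenter u).im ≤ (p i).im →
      ∃ w : HexVertex, R + 5 * δ ≤ ‖(δ : ℂ) * hexCenter w‖ ∧ PathIn hexGraph Sᶜ u w := by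
    intro i u hure hulo huhi
    obtain ⟨ha, hb⟩ := abs_le.1 hure
    have huΩ : (δ : ℂ) * hexCenter u ∉ Ω :=
      hB i _ (by rw [abs_le]; constructor <;> linarith) (by linarith) huhi
    refine twoPiece_low hδ hr hR0 hR hE hEfr hS' hXS huΩ fun x hx h1 h2 hxS => ?_
    obtain ⟨hc, hd⟩ := abs_le.1 hx
    exact hB i _ (by rw [abs_le]; constructor <;> linarith) (by linarith) (by linarith) (hS x hxS).1
  by_cases hvΩ : (δ : ℂ) * hexCenter v ∈ Ω
  · by_cases hdisc : closedBall ((δ : ℂ) * hexCenter v) r ⊆ Ω ∪ X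
    · -- `v` lies in an excluded zone
      have hz : ¬ ∀ i, ¬ (|((δ : ℂ) * hexCenter v).re - (p i).re| < ρₓ ∧ mlo i ≤ v.1 1 ∧ v.1 1 < μ i) :=
        fun h' => hv ⟨hvΩ, h', hdisc⟩
      push Not at hz
      obtain ⟨i, hvre, hvlo, hvhi⟩ := hz
      set h : ℝ := (p i).im with hh
      -- STEP 1: inward along the row, to `|ΔRe| ≤ ρc - 2δ`
      obtain ⟨v', hvv', hrow', hre'⟩ : ∃ v' : HexVertex, PathIn hexGraph Sᶜ v v' ∧ v'.1 1 = v.1 1 ∧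
          |((δ : ℂ) * hexCenter v').re - (p i).re| ≤ ρc - 2 * δ := by
        set a : ℝ := |((δ : ℂ) * hexCenter v).re - (p i).re| with ha
        set n : ℕ := ⌊(a - (ρc - 3 * δ)) / (δ / 2)⌋₊ with hn
        -- arithmetic of the number of steps
        have hδ2 : 0 < δ / 2 := by positivity
        have hnle : a - (n : ℝ) * (δ / 2) ≤ ρc - 2 * δ ∧ 0 ≤ a - (n : ℝ) * (δ / 2) := by
          rcases le_or_gt (a - (ρc - 3 * δ)) 0 with ht | ht
          · have hn0 : n = 0 := Nat.floor_of_nonpos (div_nonpos_of_nonpos_of_nonneg ht hδ2.le)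
            rw [hn0]; simp only [Nat.cast_zero, zero_mul, sub_zero]
            exact ⟨by linarith, abs_nonneg _⟩
          · have h1 : ((n : ℝ)) * (δ / 2) ≤ a - (ρc - 3 * δ) := by
              have := Nat.floor_le (div_pos ht hδ2).le
              rw [← hn] at this
              rwa [le_div_iff₀ hδ2] at this
            have h2 : a - (ρc - 3 * δ) < ((n : ℝ) + 1) * (δ / 2) := by
              have := Nat.lt_floor_add_one ((a - (ρc - 3 * δ)) / (δ / 2))
              rw [← hn] at this
              rwa [div_lt_iff₀ hδ2] at this
            constructor <;> nlinarith
        obtain ⟨hnle1, hnle2⟩ := hnle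
        have hna : (n : ℝ) * (δ / 2) ≤ a := by linarith
        rcases le_or_gt (p i).re ((δ : ℂ) * hexCenter v).re with hge | hlt
        · -- right of the centre: walk left
          have ha' : a = ((δ : ℂ) * hexCenter v).re - (p i).re := by rw [ha, abs_of_nonneg (by linarith)]
          obtain ⟨w, q, hw, hwre, hq⟩ := exists_walk_rowLeft δ hδ.le v n
          refine ⟨w, pathIn_of_walk q fun u hu huS => ?_, hw, ?_⟩
          · obtain ⟨hu1, hu2, hu3⟩ := hq u hu
            refine zoneS i u ?_ (hu1 ▸ hvlo) (hu1 ▸ hvhi) huS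
            have : a < ρₓ := hvre
            rw [abs_lt]; constructor <;> linarith
          · rw [hwre, abs_le]; constructor <;> linarith
        · -- left of the centre: walk right
          have ha' : a = -(((δ : ℂ) * hexCenter v).re - (p i).re) := by rw [ha, abs_of_neg (by linarith)]
          obtain ⟨w, q, hw, hwre, hq⟩ := exists_walk_rowRight δ hδ.le v n
          refine ⟨w, pathIn_of_walk q fun u hu huS => ?_, hw, ?_⟩
          · obtain ⟨hu1, hu2, hu3⟩ := hq u hu
            refine zoneS i u ?_ (hu1 ▸ hvlo) (hu1 ▸ hvhi) huS
            have : a < ρₓ := hvre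
            rw [abs_lt]; constructor <;> linarith
          · rw [hwre, abs_le]; constructor <;> linarith
      obtain ⟨hre'1, hre'2⟩ := abs_le.1 hre'
      have hv'lo : mlo i ≤ v'.1 1 := hrow' ▸ hvlo
      have hv'hi : v'.1 1 < μ i := hrow' ▸ hvhi
      by_cases him : h < ((δ : ℂ) * hexCenter v').im
      · -- STEP 2: the column down to the floor
        set L : ℝ := ((δ : ℂ) * hexCenter v').im - h with hL
        obtain ⟨w₁, q, hw₁, hq⟩ := exists_walk_column hδ v' (L := L) (by rw [hL]; linarith)
        have hv'w₁ : PathIn hexGraph Sᶜ v' w₁ := by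
          refine pathIn_of_walk q fun u hu huS => ?_
          obtain ⟨hu1, hu2, hu3, -⟩ := hq u hu
          obtain ⟨hu3a, hu3b⟩ := abs_le.1 hu3
          refine zoneS i u ?_ (hmlo i u ?_) ((row_le_of_im_le hδ hu1).trans_lt hv'hi) huS
          · rw [abs_lt]; constructor <;> linarith
          · rw [hL] at hu2; linarith
        have hw₁s := hq w₁ q.end_mem_support
        obtain ⟨-, hw₁lo, hw₁re, -⟩ := hw₁s
        obtain ⟨hc, hd⟩ := abs_le.1 hw₁re
        rw [hL] at hw₁ hw₁lo
        obtain ⟨w, hw, hw₁w⟩ := lowB i w₁ (by rw [abs_le]; constructor <;> linarith) (by linarith)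
          (by linarith)
        exact ⟨w, hw, (hvv'.trans hv'w₁).trans hw₁w⟩
      · -- `v'` itself is on or below the floor, inside the removed box
        push Not at him
        obtain ⟨w, hw, hv'w⟩ := lowB i v' (by rw [abs_le]; constructor <;> linarith)
          (by linarith [hzone i v' hv'lo]) him
        exact ⟨w, hw, hvv'.trans hv'w⟩
    · -- a witness in the disc
      obtain ⟨y, hy, hyU⟩ := not_subset.1 hdisc
      exact twoPiece_witness hδ hr hR0 hR hE hEfr hS' hXS hyU (by rw [dist_comm]; exact mem_closedBall.1 hy)
  · by_cases hvX : (δ : ℂ) * hexCenter v ∈ X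
    · -- in an exempt slab, outside `Ω`: the low route through the zone
      obtain ⟨i, hvre, hvlo, hvhi⟩ := hX _ hvX
      obtain ⟨ha, hb⟩ := abs_le.1 hvre
      refine twoPiece_low hδ hr hR0 hR hE hEfr hS' hXS hvΩ fun x hx h1 h2 hxS => ?_
      obtain ⟨hc, hd⟩ := abs_le.1 hx
      exact zoneS i x (by rw [abs_lt]; constructor <;> linarith) (hmlo i x (by linarith))
        (hμ i x (by linarith)) hxS
    · -- `δ c_v` itself is a witness
      exact twoPiece_witness hδ hr hR0 hR hE hEfr hS' hXS (fun h' => h'.elim hvΩ hvX)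
        (by rw [dist_self]; exact hr0)

/-- **Registered sub-goal `stub_carvedReduction_twoPieceEscape`** (crux item
stmt-CriticalPhenomena-10472, stub T2b″ `stub_carvedReduction_squeezeSolid`, piece (G2-fam-b) THE
TWO-PIECE ESCAPE LEMMA, flatness-free form): registry form of `twoPiece_exists_pathIn_escape`. -/
theorem stub_carvedReduction_twoPieceEscape :
    ∀ (Ω X : Set ℂ) (p : Fin 2 → ℂ) (δ r R ρₓ ρc ρc' σ D : ℝ) (μ mlo : Fin 2 → ℤ) (S : Set HexVertex)
      (v : HexVertex),
      0 < δ → 9 * δ ≤ r → 0 ≤ R → (∀ z ∈ Ω, ‖z‖ < R) → IsConnected (closure Ω)ᶜ →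
      frontier (closure Ω)ᶜ = frontier Ω →
      3 * δ ≤ ρc → ρc ≤ ρₓ → 8 * δ ≤ ρc' → σ + 10 * δ ≤ D → 0 ≤ σ →
      (∀ u ∈ S, (δ : ℂ) * hexCenter u ∈ Ω ∧
        (∀ i, ¬ (|((δ : ℂ) * hexCenter u).re - (p i).re| < ρₓ ∧ mlo i ≤ u.1 1 ∧ u.1 1 < μ i)) ∧
        closedBall ((δ : ℂ) * hexCenter u) r ⊆ Ω ∪ X) →
      (∀ z ∈ X, ∃ i, |z.re - (p i).re| ≤ ρₓ - 10 * δ ∧ (p i).im - σ ≤ z.im ∧ z.im ≤ (p i).im) →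
      (∀ i (z : ℂ), |z.re - (p i).re| ≤ ρc → (p i).im - ρc' ≤ z.im → z.im ≤ (p i).im → z ∉ Ω) →
      (∀ i (u : HexVertex), ((δ : ℂ) * hexCenter u).im ≤ (p i).im → u.1 1 < μ i) →
      (∀ i (u : HexVertex), (p i).im - D ≤ ((δ : ℂ) * hexCenter u).im → mlo i ≤ u.1 1) →
      (∀ i (u : HexVertex), mlo i ≤ u.1 1 → (p i).im - ρc' + 8 * δ ≤ ((δ : ℂ) * hexCenter u).im) →
      ¬ ((δ : ℂ) * hexCenter v ∈ Ω ∧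
        (∀ i, ¬ (|((δ : ℂ) * hexCenter v).re - (p i).re| < ρₓ ∧ mlo i ≤ v.1 1 ∧ v.1 1 < μ i)) ∧
        closedBall ((δ : ℂ) * hexCenter v) r ⊆ Ω ∪ X) →
      ∃ w : HexVertex, R + 5 * δ ≤ ‖(δ : ℂ) * hexCenter w‖ ∧ PathIn hexGraph Sᶜ v w :=
  fun _ _ _ _ _ _ _ _ _ _ _ _ _ _ _ hδ hr hR0 hR hE hEfr hρc hρcₓ hρc' hσD hσ hS hX hB hμ hmlo hzone hv =>
    twoPiece_exists_pathIn_escape hδ hr hR0 hR hE hEfr hρc hρcₓ hρc' hσD hσ hS hX hB hμ hmlo hzone hv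

end TwoPieceEscape

end Summit.CriticalPhenomena.SAWScalingLimit.Theorems.ObservableToSLE.TypeLadder

end

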